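import Summits.QuantumFields.YangMills.Theorems.LuscherReductionTwistedTraceScalingBTRatesKappa
import Summits.QuantumFields.YangMills.Theorems.LuscherReductionTwistedTraceScalingBTRatesBudget
import HarnessLib

/-!
# ★★★ (B-T) IS UNCONDITIONAL: `recordBT_hT`, and the record analytic input follows from (B-ST) + (B-OD) alone
# (lane A of S-BASE, crux `TwistedTraceScaling` stmt-QuantumFields-20203, C4-CORE, the (B-T) pen; design note `pub/ym-fleet/ym-luscher-20007-p1/COARSE-DESIGN.md` §25.9)

* `integral_btOmega_pos`, `btConst_pos` (`β ≥ 0`), `btSlow_pos` — the slow factor of record `σ = C/Z/γ` is positive (core floor `…BTCoreFloor.fpBOKernel_one_one_ge`,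
  Haar floor, and the fibre profile charges every ball);
* `eventually_small` — all thirteen conjuncts of the smallness hypothesis of `…BTSchedule.recordBT_hT_of_eventually` (`…BTRatesAtoms` + `…BTRatesCore`);
* ★★★ `recordBT_hT` — **the brick (B-T) of `RecordAnalyticInput`, unconditionally**, for `Ω = btOmega L`, `σ = btSlow L` (spelled out), rate `btRate L s`, every `0 < s < 1/2`:
  `recordBT_hT_of_eventually` fed with `eventually_small` and `…BTRatesBudget.eventually_budget`;
* ★★★ `recordAnalyticInput_of_stiff_offDiag` — for `1/6 < s ≤ 1/4`: the two remaining analytic bricks (B-ST) (stiff domination against `btOmega`, slow factor `btSlow`) and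
  (B-OD) (off-diagonal, rate `b` with `b² = o(λ_b)`) ALONE give `Nonempty (RecordAnalyticInput L s M)` (Ω, r, σ, κ and the fields hΩ*, hr*, hγ, hσ, hκ*, hT are all supplied here;
  `σ β := if 0 < btSlow L β then btSlow L β else 1`, which equals `btSlow L β` for `β ≥ 0`);
* ★★ `innerNoIntruderOneOrbitAt_of_stiff_offDiag` — hence C4-CORE(s) `InnerNoIntruderOneOrbitAt L β^{-s}` (`1/6 < s < 1/5`, `L` with a nonzero site) from (B-ST)(M) + (B-OD)(M), `M ≥ M₀`.
WHAT REMAINS of C4-CORE after this file: exactly (B-ST) and (B-OD) (lanes B/C of COARSE-DESIGN §24–§25).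
HONEST FRAMING: a stub of a child of the CONDITIONAL reduction route R2b1; C4-CORE OPEN ((B-ST), (B-OD)); not infinite volume, not a gap, not Clay.
-/

set_option autoImplicit false

noncomputable section

open MeasureTheory Filter Topology Real Asymptotics
open scoped BigOperators
open Literature.MathematicalPhysics.QuantumFieldTheory
open Literature.MathematicalPhysics.QuantumLattice

namespace Summit.QuantumFields.YangMills.Theorems.FemtoTransferGap.TwoLattice.ConstTube

open Summit.QuantumFields.YangMills.Theorems.FemtoTransferGap
open Summit.QuantumFields.YangMills.Theorems.FemtoTransferGap.TwoLattice
open Summit.QuantumFields.YangMills.Theorems.FemtoTransferGap.TwoLattice.Avg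
open Summit.QuantumFields.YangMills.Theorems.FemtoTransferGap.TwoLattice.Stiff (LinkSpace)
open Summit.QuantumFields.YangMills.Theorems.FemtoTransferGap.TwoLattice.Cov

variable {L : ℕ} [NeZero L]

/-! ## §1 The slow factor of record is positive -/

/-- `∫ Ω_β(v̂) dπ(v) > 0` for the profile of record: `Ω ≥ 0` is measurable, bounded, and nonzero on the open ball of radius `btRad β > 0`, which `π` charges. [folklore] -/
theorem integral_btOmega_pos (β : ℝ) : 0 < ∫ v, btOmega L β (linkEmbed L v) ∂orthoTransverse L := by
  haveI := isFiniteMeasure_orthoTransverse L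
  obtain ⟨hΩm, hΩ1, -, -, -⟩ := btOmega_fields (L := L)
  have hf0 : ∀ v : Edge 3 L → Fin 3 → ℝ, 0 ≤ btOmega L β (linkEmbed L v) := fun v => btOmega_nonneg β _
  have hfm : Measurable fun v : Edge 3 L → Fin 3 → ℝ => btOmega L β (linkEmbed L v) := (hΩm β).comp (measurable_linkEmbed L)
  have hint : Integrable (fun v : Edge 3 L → Fin 3 → ℝ => btOmega L β (linkEmbed L v)) (orthoTransverse L) :=
    integrable_of_measurable_abs_le _ hfm (C := 1) fun v => hΩ1 β _
  rw [integral_pos_iff_support_of_nonneg hf0 hint]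
  refine lt_of_lt_of_le (orthoTransverse_ball_pos L (btRad_pos_le β).1) (measure_mono fun v hv => ?_)
  exact frozenProfile_ne_zero_of_norm_lt (L := L) (fun _ _ => 0) btRad β hv

/-- **`0 < btConst L β`** for `β ≥ 0`: the core floor at the vacuum pair, the Haar floor of the quaternion core and `∫Ω dπ > 0`. [cite: Luscher1983, §3] -/
theorem btConst_pos {β : ℝ} (hβ : 0 ≤ β) : 0 < btConst L β := by
  obtain ⟨hΩm, hΩ1, -, -, -⟩ := btOmega_fields (L := L)
  obtain ⟨hε0, hε1⟩ := btEps_pos_le β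
  have hx0 := powScale_pos (1 / 2) β
  have hρR : 2 * (btEps β / 3) < btR1 β := by
    have hεx : btEps β ≤ powScale (1 / 2) β := powScale_le_powScale (by norm_num) β
    have h1 : 5 * powScale (1 / 2) β * 1 ≤ 5 * powScale (1 / 2) β * btLog β := mul_le_mul_of_nonneg_left (one_le_btLog β) (by positivity)
    unfold btR1; linarith
  have hρε : 2 * (btEps β / 3) < btEps β := by linarith
  have hρ1 : btEps β / 3 < 1 := by linarith
  have hfloor := fpBOKernel_one_one_ge hβ (hΩm β) (hΩ1 β) (btOmega_nonneg β) (measurable_coreWeight (L := L) (btEps β) (btR1 β))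
    (abs_coreWeight_le (btEps β) (btR1 β)) (fun g => (coreWeight_mem_Icc (btEps β) (btR1 β) g).1) (by linarith : 0 ≤ btEps β / 3)
    (by linarith [(btRad_pos_le β).2] : btRad β ≤ 1 / 30) (fun g hg => coreWeight_ge_one_of_mem_gaugeCore hρR hρε hρ1 hg) (btOmega_support β)
  have hρ0 : 0 < btEps β / 3 := by linarith
  have hG : 0 < (gaugeMeasure L).real (gaugeCore L (btEps β / 3)) :=
    lt_of_lt_of_le (by positivity) (gaugeMeasure_real_gaugeCore_ge (L := L) hρ0 (by linarith))
  have hI := integral_btOmega_pos (L := L) β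
  have hpos : 0 < fpBOKernel L β (btOmega L β) (coreWeight L (btEps β) (btR1 β)) 1 1 :=
    lt_of_lt_of_le (mul_pos (mul_pos (Real.exp_pos _) hG) (pow_pos hI 2)) hfloor
  unfold btConst btC
  exact div_pos hpos (transferKernel_pos _ _ _ _)

/-- **`0 < btSlow L β`** (`= C/Z/γ`) for `β ≥ 0`. [folklore] -/
theorem btSlow_pos {β : ℝ} (hβ : 0 ≤ β) : 0 < btSlow L β := by
  unfold btSlow
  exact div_pos (div_pos (btConst_pos hβ) (fpZ_pos (btEps_pos_le β).1)) ((btOmega_fields (L := L)).2.2.2.2 β)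

/-! ## §2 ★★★ (B-T), unconditionally -/

/-- **All thirteen conjuncts of the smallness hypothesis**, eventually (`0 < s < 1/2`). [folklore] -/
theorem eventually_small {s : ℝ} (hs : 0 < s) (hs2 : s < 1 / 2) :
    ∀ᶠ β : ℝ in atTop, 0 ≤ β ∧ recordDelta1 L s β ≤ 1 / 2 ∧ btAlpha β ≤ 1 ∧ btRad β ≤ 9 * L * btR1 β + btEps β ∧ 9 * L * btR1 β + btEps β ≤ 1 / 30 ∧
      (L : ℝ) ^ 3 * (12 * recordDelta1 L s β ^ 4) < 2 ∧
      coreEps1 L β (recordDelta1 L s β) (9 * L * btR1 β + btEps β) (btRad β) +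
          coreEps2 L β (recordDelta1 L s β) (9 * L * btR1 β + btEps β) (btRad β) ((L : ℝ) ^ 3 * (12 * recordDelta1 L s β ^ 4)) ≤ 1 ∧
      18 * L * (Real.sqrt 2 * btRad β + recordDelta1 L s β) ≤ 1 / 2 ∧
      0 ≤ btR1 β / 2 - 2 * (Real.sqrt 2 * btRad β + recordDelta1 L s β) * btEps β - (2 * Real.sqrt 2 * btRad β + btAlpha β) ∧
      0 ≤ 1 / (3 * L) - 4 * (Real.sqrt 2 * btRad β + recordDelta1 L s β) - (2 * Real.sqrt 2 * btRad β + btAlpha β) ∧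
      3 * L * (13 * recordDelta1 L s β) < 1 ∧
      0 ≤ 13 * recordDelta1 L s β - 4 * (Real.sqrt 2 * btRad β + recordDelta1 L s β) - (2 * Real.sqrt 2 * btRad β + 2 * recordDelta1 L s β) ∧
      2 * btEps β * Fintype.card (Site 3 L) * recordDelta1 L s β + 2 * btRad β ^ 2 +
          2 * Real.sqrt 2 * Fintype.card (Site 3 L) * (9 * L * (13 * recordDelta1 L s β) + btEps β) * btRad β ≤
        Fintype.card (Site 3 L) * (1 - 3 * L * (13 * recordDelta1 L s β)) * btAlpha β := by
  filter_upwards [eventually_small_elementary (L := L) hs hs2, eventually_coreEps_sum_le_one (L := L) hs hs2] with β h hε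
  obtain ⟨h1, h2, h3, h4, h5, h6, h7, h8, h9, h10, h11, h12⟩ := h
  exact ⟨h1, h2, h3, h4, h5, h6, hε, h7, h8, h9, h10, h11, h12⟩

/-- ★★★ **(B-T) OF THE RECORD ANALYTIC INPUT, UNCONDITIONALLY** (`0 < s < 1/2`): for gauge-invariant bounded measurable `φ` supported in the window `{orbitDist < δ₁(β)}`,
`|T_β(boFun φ Ω_β) − σ(β)γ(β)·Q_{L³β}(φ)| ≤ κ(β)·σ(β)γ(β)·(Q_{L³β}(φ) + λ₀(L³β)‖φ‖²)` eventually, with `Ω = btOmega L`, `σ = C/Z/γ` (= `btSlow L`), `κ = btRate L s`.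
[cite: Luscher1983, §3] -/
theorem recordBT_hT {s : ℝ} (hs : 0 < s) (hs2 : s < 1 / 2) :
    ∀ᶠ β : ℝ in atTop, ∀ φ : GaugeConfig 3 1 SU2 → ℝ, Measurable φ → (∃ C : ℝ, ∀ u, |φ u| ≤ C) →
      (∀ (g : Site 3 1 → SU2) (u : GaugeConfig 3 1 SU2), φ (gaugeTransform g u) = φ u) → (∀ u, φ u ≠ 0 → orbitDist u < recordDelta1 L s β) →
      |tubeForm β (boFun L φ (btOmega L β)) - (btConst L β / fpZ (btEps β) / recordGamma L (btOmega L) β) * recordGamma L (btOmega L) β * qform su2Rep ((L : ℝ) ^ 3 * β) φ φ| ≤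
        btRate L s β * ((btConst L β / fpZ (btEps β) / recordGamma L (btOmega L) β) * recordGamma L (btOmega L) β) *
          (qform su2Rep ((L : ℝ) ^ 3 * β) φ φ + levelValue su2Rep 1 ((L : ℝ) ^ 3 * β) 0 * l2 φ φ) :=
  recordBT_hT_of_eventually hs (eventually_small hs hs2) (eventually_budget hs hs2)

/-! ## §3 ★★★ The record analytic input from (B-ST) and (B-OD) alone -/

/-- ★★★ **`RecordAnalyticInput L s M` FROM (B-ST) AND (B-OD) ALONE** (`1/6 < s ≤ 1/4`): the fibre profile `btOmega`, radius `btRad`, slow factor `btSlow` (made positive everywhere by an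
`if`, harmless since the bricks are eventual), rate `btRate`, and every Ω/r/γ/σ/κ field together with (B-T) come from this pen; the successor supplies only the stiff domination (B-ST)
with its gap `θ₀ ∈ (0,1]` and the off-diagonal brick (B-OD) with its rate `b ≥ 0`, `b² = o(λ_b(L³β))`. [cite: Luscher1983, §3] [cite: SjostrandZworski2007, §2] -/
theorem recordAnalyticInput_of_stiff_offDiag {s M : ℝ} (hs6 : 1 / 6 < s) (hs4 : s ≤ 1 / 4) {b : ℝ → ℝ} {θ₀ : ℝ} (hb : ∀ β, 0 ≤ b β)
    (hb_small : ∀ a : ℝ, 0 < a → ∀ᶠ β in atTop, b β ^ 2 ≤ a * bareLambda ((L : ℝ) ^ 3 * β)) (hθ₀ : 0 < θ₀ ∧ θ₀ ≤ 1)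
    (hST : ∀ᶠ β in atTop, ∀ v : GaugeConfig 3 L SU2 → ℝ, Measurable v → (∃ C : ℝ, ∀ U, |v U| ≤ C) → (∀ U, v U ≠ 0 → recordChi L s 43 M β U ≠ 0) →
      (∀ u, fibreInner L (softWeight (recordChi L s 43 M β)) (btOmega L β) v u = 0) →
      tubeForm β v ≤ (1 - θ₀) * (btSlow L β * levelValue su2Rep 1 ((L : ℝ) ^ 3 * β) 0) * tubeNormSq (softWeight (recordChi L s 43 M β)) v)
    (hOD : ∀ᶠ β in atTop, ∀ (φ : GaugeConfig 3 1 SU2 → ℝ) (v : GaugeConfig 3 L SU2 → ℝ), Measurable φ → (∃ C : ℝ, ∀ u, |φ u| ≤ C) →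
      (∀ u, φ u ≠ 0 → orbitDist u < recordDelta1 L s β) → Measurable v → (∃ C : ℝ, ∀ U, |v U| ≤ C) → (∀ U, v U ≠ 0 → recordChi L s 43 M β U ≠ 0) →
      (∀ u, fibreInner L (softWeight (recordChi L s 43 M β)) (btOmega L β) v u = 0) →
      |tubeCross β (boFun L φ (btOmega L β)) v| ≤ b β * (btSlow L β * levelValue su2Rep 1 ((L : ℝ) ^ 3 * β) 0) *
          Real.sqrt (tubeNormSq (softWeight (recordChi L s 43 M β)) (boFun L φ (btOmega L β))) * Real.sqrt (tubeNormSq (softWeight (recordChi L s 43 M β)) v) ∧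
      |tubeCross β v (boFun L φ (btOmega L β))| ≤ b β * (btSlow L β * levelValue su2Rep 1 ((L : ℝ) ^ 3 * β) 0) *
          Real.sqrt (tubeNormSq (softWeight (recordChi L s 43 M β)) (boFun L φ (btOmega L β))) * Real.sqrt (tubeNormSq (softWeight (recordChi L s 43 M β)) v)) :
    Nonempty (RecordAnalyticInput L s M) := by
  have hs0 : 0 < s := by linarith
  have hs2 : s < 1 / 2 := by linarith
  obtain ⟨hΩm, hΩ1, hΩinv, hΩr, hγ⟩ := btOmega_fields (L := L)
  set σ : ℝ → ℝ := fun β => if 0 < btSlow L β then btSlow L β else 1 with hσdef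
  have hσpos : ∀ β, 0 < σ β := fun β => by
    rw [hσdef]; dsimp only
    split_ifs with h
    · exact h
    · exact one_pos
  have hσeq : ∀ᶠ β : ℝ in atTop, σ β = btSlow L β :=
    (eventually_ge_atTop (0 : ℝ)).mono fun β hβ => by rw [hσdef]; dsimp only; rw [if_pos (btSlow_pos hβ)]
  refine ⟨
    { Ω := btOmega L, r := btRad, σ := σ, κ := btRate L s, b := b, θ₀ := θ₀,
      hΩm := hΩm, hΩ1 := hΩ1, hΩinv := hΩinv, hΩr := hΩr, hr := btRad_le_half, hr_small := eventually_btRad_small hs2, hγ := hγ,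
      hσ := hσpos, hκ0 := btRate_nonneg s, hκ_dom := btRate_dom s, hκ_small := btRate_small hs6 hs4, hb := hb, hb_small := hb_small, hθ₀ := hθ₀,
      hT := ?_, hST := ?_, hOD := ?_ }⟩
  · filter_upwards [recordBT_hT (L := L) hs0 hs2, hσeq] with β h he
    rw [he]
    exact h
  · filter_upwards [hST, hσeq] with β h he
    rw [he]
    exact h
  · filter_upwards [hOD, hσeq] with β h he
    rw [he]
    exact h

/-- ★★ **C4-CORE(s) FROM (B-ST) + (B-OD)** (`1/6 < s < 1/5`, `L` with a nonzero site): for `M ≥ M₀(L)`, the stiff domination and the off-diagonal brick against the record data give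
`InnerNoIntruderOneOrbitAt L β^{-s}`. [cite: Luscher1983, §3] -/
theorem innerNoIntruderOneOrbitAt_of_stiff_offDiag (hL : Nonempty (NzSite L)) {s : ℝ} (hs6 : 1 / 6 < s) (hs5 : s < 1 / 5) :
    ∃ M₀ : ℝ, 2 ≤ M₀ ∧ ∀ M : ℝ, M₀ ≤ M → ∀ (b : ℝ → ℝ) (θ₀ : ℝ), (∀ β, 0 ≤ b β) →
      (∀ a : ℝ, 0 < a → ∀ᶠ β in atTop, b β ^ 2 ≤ a * bareLambda ((L : ℝ) ^ 3 * β)) → (0 < θ₀ ∧ θ₀ ≤ 1) →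
      (∀ᶠ β in atTop, ∀ v : GaugeConfig 3 L SU2 → ℝ, Measurable v → (∃ C : ℝ, ∀ U, |v U| ≤ C) → (∀ U, v U ≠ 0 → recordChi L s 43 M β U ≠ 0) →
        (∀ u, fibreInner L (softWeight (recordChi L s 43 M β)) (btOmega L β) v u = 0) →
        tubeForm β v ≤ (1 - θ₀) * (btSlow L β * levelValue su2Rep 1 ((L : ℝ) ^ 3 * β) 0) * tubeNormSq (softWeight (recordChi L s 43 M β)) v) →
      (∀ᶠ β in atTop, ∀ (φ : GaugeConfig 3 1 SU2 → ℝ) (v : GaugeConfig 3 L SU2 → ℝ), Measurable φ → (∃ C : ℝ, ∀ u, |φ u| ≤ C) →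
        (∀ u, φ u ≠ 0 → orbitDist u < recordDelta1 L s β) → Measurable v → (∃ C : ℝ, ∀ U, |v U| ≤ C) → (∀ U, v U ≠ 0 → recordChi L s 43 M β U ≠ 0) →
        (∀ u, fibreInner L (softWeight (recordChi L s 43 M β)) (btOmega L β) v u = 0) →
        |tubeCross β (boFun L φ (btOmega L β)) v| ≤ b β * (btSlow L β * levelValue su2Rep 1 ((L : ℝ) ^ 3 * β) 0) *
            Real.sqrt (tubeNormSq (softWeight (recordChi L s 43 M β)) (boFun L φ (btOmega L β))) * Real.sqrt (tubeNormSq (softWeight (recordChi L s 43 M β)) v) ∧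
        |tubeCross β v (boFun L φ (btOmega L β))| ≤ b β * (btSlow L β * levelValue su2Rep 1 ((L : ℝ) ^ 3 * β) 0) *
            Real.sqrt (tubeNormSq (softWeight (recordChi L s 43 M β)) (boFun L φ (btOmega L β))) * Real.sqrt (tubeNormSq (softWeight (recordChi L s 43 M β)) v)) →
      InnerNoIntruderOneOrbitAt L (powScale s) := by
  obtain ⟨M₀, hM₀, h⟩ := innerNoIntruderOneOrbitAt_of_analyticInput (L := L) hL (by linarith) hs5
  refine ⟨M₀, hM₀, fun M hM b θ₀ hb hbs hθ hST hOD => ?_⟩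
  obtain ⟨A⟩ := recordAnalyticInput_of_stiff_offDiag (M := M) hs6 (by linarith) hb hbs hθ hST hOD
  exact h M hM A

end Summit.QuantumFields.YangMills.Theorems.FemtoTransferGap.TwoLattice.ConstTube

end
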